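import Summits.QuantumFields.YangMills.Theorems.PoincareLipschitzRegaugedTowerStep
import HarnessLib

/-!
# Crux stmt-QuantumFields-19936 `UnitScaleTilt.HistoryTailL`, K2 at depth (route crux `PoincareLipschitz.BlockLipschitzL`, stmt-QuantumFields-23533),
# K2 supplier plan of record (card v1.27 (c)), file F5b-4 — THE RE-GAUGED NONLINEAR TOWER, k-UNIFORM, IN THE SMALL-DATA REGIME:
# `∃ h : GaugeTransf P k SU(2)`, `‖Y(Ū^{(k)}(U), (Ū^{(k)}U')^h)‖_{ℓ²(S_k)} ≤ 2·ρ^k·‖Y(U, U')‖_{ℓ²(S_0)}`, `ρ = √((L^d)⁻¹L²)` (= `L^{−k/2}` gain at d = 3)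

Cell `ym3-torus` (YM ladder rung R3 = continuum SU(2) Yang–Mills on the three-torus — a RUNG, NOT the Clay problem: not d = 4, not infinite
volume, not a mass gap); width seat `ym-ust-19936-w2` g10, pen F5 of the K2 supplier plan (LEAD `ym-ust-19936-w1` g7, 2026-08-29T00:35:51Z;
memo `R4-LOCATE-w2g10.md` §3 «WITHOUT (R3) … the same induction closes hStab VERBATIM in the SMALL-DATA REGIME»).  Helper
`--supports stmt-QuantumFields-19936`; THEOREMS ONLY (0 `def`, 0 `sorry`); `Params`-generic, gauge group `SU(2)`, average of record
`ℰ = expMeanLogSU`.  Nothing here proves `hStab`, a stub, `BlockLipschitzL`, `HistoryTailL` or a summit statement.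

THE INDUCTION (print's inductive re-gauging, [Balaban1985Averaging] §3 (156)–(163), in `ℓ²` currency).  Data: level-0 fields `U, U'`, a tower of
bond sets `S_0, S_1, …, S_k` closed under «two-block neighbourhood of a bond of `S_{i+1}` ⊆ `S_i`», loop-size bounds `α_i` for the background tower
`Ū^{(i)} = Averaging.iter (blockAvg ℰ) i U` on `S_{i+1}`, the datum `X ≥ ‖pertVar U U'‖_{ℓ²(S_0)}`, and the box-local rows ROW-L∕ROW-M at every
level (pen `ym3-torus-px7`, displayed).  Claim `P(i)`: `∃ h_i : GaugeTransf P i SU(2)`,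
`Σ_{S_i}‖pertVar Ū^{(i)} (Ū'^{(i)})^{h_i}‖² ≤ (X·ρ^i·exp((κ/ρ)Σ_{i'<i} q̄_{i'}))²`, `q̄_i = 159α_i + 1040·C₁·ρ^i·X`.  `P(0)`: `h_0 = 1`.  `P(i) ⇒ P(i+1)`: the level
step ✓`PoincareLipschitzRegaugedTowerStep.exists_regauge_sum_normSq_le` at `V := Ū^{(i)}`, `W := (Ū'^{(i)})^{h_i}`, `M := Xρ^iE_i ≤ 2Xρ^i` gives `g`
with `ℓ²(S_{i+1})`-norm `≤ (ρ + κ(159α_i + 520C₁M))·M ≤ ρ(1 + κq̄_i/ρ)·M ≤ Xρ^{i+1}E_{i+1}` (`1 + x ≤ eˣ`); covariance `avgFun ℰ (W^{h}) = (avgFun ℰ W)^{h∘emb}`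
(✓`BlockAveraging.avgFun_covariant`) and `(V^{v})^{u} = V^{u·v}` make `h_{i+1} := g·(h_i ∘ emb)` a gauge copy of `Ū'^{(i+1)}` again.  The exponent
`(κ/ρ)Σq̄ ≤ 1/2` keeps `E_i ≤ 2`, and the guards of the step (`72C₁M ≤ 1`, `3C₁M + α_i < δ_2`) follow from `144C₁X ≤ 1`, `6C₁X + α_i < δ_2`.

WHAT IS PROVED (ns `…Theorems.PoincareLipschitzRegaugedTowerInduction`).
* §1 `gaugeAct_mul_gaugeAct`, `gaugeAct_const_one`, `iter_succ_eq_avgFun`, `add_mul_le_mul_exp` (letters).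
* §2 ★★★ `exists_regauged_tower` — the invariant `P(i)` for every `i ≤ k`; ★★★ `exists_regauge_top_sum_normSq_le` — the title at the top level
  (`≤ (2·ρ^k·X)²`), both modulo the displayed rows ROW-L∕ROW-M (quantified over the levels `i < k` and all level-`i` fields).
HONEST SCOPE.  Induction bookkeeping over F5b-3; the rows are displayed; the reading sets, the windows → `α_i`, the sum `Σq̄` and the `T3Family`
packaging to hStab's letters are the sequel.  Nothing of [Balaban1985Averaging] is asserted beyond the cited tree theorems.

References: T. Bałaban, CMP 98 (1985) 17–51 [Balaban1985Averaging] (Prop. 3 (122)–(126) p.36, (11) p.19, §3 (156)–(163)); CMP 109 (1987) 249–301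
[Balaban1987RG1] ((0.4), (0.11) p.253).
-/

noncomputable section

open scoped BigOperators Matrix.Norms.L2Operator
open NormedSpace

namespace Summit.QuantumFields.YangMills.Theorems.PoincareLipschitzRegaugedTowerInduction

open Literature.MathematicalPhysics.QuantumFieldTheory.Balaban1983to89
open Finset T4Continuum BlockAveraging AveragingRT ExpMeanLog BlockAveragingEMLLinearised BlockAveragingEMLLinearisedBackground BlockAveragingEMLProp2
open Summit.QuantumFields.YangMills.Theorems.PoincareLipschitzRegaugedTowerStep (exists_regauge_sum_normSq_le)

variable {P : Params}

/-! ## §1 Letters -/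

/-- Composition of gauge actions: `(V^{v})^{u} = V^{u·v}`. [cite: Balaban1985Averaging, (8) p.19] -/
theorem gaugeAct_mul_gaugeAct {j : ℕ} {G : Type*} [GaugeGroup G] (u v : GaugeTransf P j G) (V : GaugeField P j G) :
    GaugeField.gaugeAct u (GaugeField.gaugeAct v V) = GaugeField.gaugeAct (fun y => u y * v y) V := by
  funext b
  simp only [GaugeField.gaugeAct, mul_inv_rev, mul_assoc]

/-- The trivial gauge action. [cite: Balaban1985Averaging, (8) p.19] -/
theorem gaugeAct_const_one {j : ℕ} {G : Type*} [GaugeGroup G] (V : GaugeField P j G) :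
    GaugeField.gaugeAct (fun _ => (1 : G)) V = V := by
  funext b; simp [GaugeField.gaugeAct]

/-- One more averaging: `Ū^{(i+1)} = avgFun ℰ (Ū^{(i)})` for the block averaging of record. [cite: Balaban1987RG1, (0.11) p.253] -/
theorem iter_succ_eq_avgFun (i : ℕ) (U : GaugeField P 0 (Matrix.specialUnitaryGroup (Fin 2) ℂ)) :
    Averaging.iter (fun i' => blockAvg (P := P) (j := i') (expMeanLogSU (n := Fin 2))) (i + 1) U =
      avgFun (expMeanLogSU (n := Fin 2)) (Averaging.iter (fun i' => blockAvg (P := P) (j := i') (expMeanLogSU (n := Fin 2))) i U) := rfl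

/-- `(ρ + κq)·M ≤ ρ·exp(κq/ρ)·M` for `ρ > 0`, `κq ≥ 0`, `M ≥ 0` (`1 + x ≤ eˣ`). [folklore] -/
theorem add_mul_le_mul_exp {ρ κq M : ℝ} (hρ : 0 < ρ) (hκq : 0 ≤ κq) (hM : 0 ≤ M) : (ρ + κq) * M ≤ ρ * Real.exp (κq / ρ) * M := by
  have h1 : ρ + κq = ρ * (1 + κq / ρ) := by field_simp
  have h2 : 1 + κq / ρ ≤ Real.exp (κq / ρ) := by
    have := Real.add_one_le_exp (κq / ρ); linarith
  rw [h1]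
  exact mul_le_mul_of_nonneg_right (mul_le_mul_of_nonneg_left h2 hρ.le) hM

/-! ## §2 The tower -/

set_option maxHeartbeats 400000 in
/-- ★★★ **THE RE-GAUGED NONLINEAR TOWER, EVERY LEVEL.**  See the module docstring for the data.  For every `i ≤ k` there is a level-`i` gauge
transformation `h` with `Σ_{b∈S i}‖pertVar (Ū^{(i)} U) ((Ū^{(i)} U')^h) b‖² ≤ (X·ρ^i·exp((κ/ρ)·Σ_{i'<i}(159α_{i'} + 1040·C₁·ρ^{i'}·X)))²`.
[cite: Balaban1985Averaging, Prop. 3 (122)-(126) p.36] -/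
theorem exists_regauged_tower {k : ℕ} (hk : k ≤ P.m + P.K) (U U' : GaugeField P 0 (Matrix.specialUnitaryGroup (Fin 2) ℂ))
    (S : (i : ℕ) → Finset (PBond P i))
    (hS : ∀ i, i < k → ∀ c ∈ S (i + 1), ∀ b : PBond P i, (blockOf b.src = c.src ∨ blockOf b.src = c.tgt) → b ∈ S i)
    (α : ℕ → ℝ) (hα0 : ∀ i, i < k → 0 ≤ α i) (hα24 : ∀ i, i < k → α i ≤ 1 / 24)
    (hα : ∀ i, i < k → ∀ c ∈ S (i + 1), ∀ idx : Idx P,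
      dist1 (loopHol (Averaging.iter (fun i' => blockAvg (P := P) (j := i') (expMeanLogSU (n := Fin 2))) i U) c idx) ≤ α i)
    {X : ℝ} (hX0 : 0 ≤ X) (hX : ∑ b ∈ S 0, ‖pertVar U U' b‖ ^ 2 ≤ X ^ 2)
    (hρ1 : ((P.L : ℝ) ^ P.d)⁻¹ * (P.L : ℝ) ^ 2 ≤ 1)
    (hsmallX : 144 * ((((P.d + 2) * P.L : ℕ) : ℝ) * Real.sqrt (2 * P.d * (P.L : ℝ) ^ P.d) * X) ≤ 1)
    (hN : ∀ i, i < k → 6 * ((((P.d + 2) * P.L : ℕ) : ℝ) * Real.sqrt (2 * P.d * (P.L : ℝ) ^ P.d) * X) + α i < deltaSU (Fin 2))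
    (hsum : (((P.d + 2) * P.L : ℕ) : ℝ) * Real.sqrt (2 * P.d * (P.L : ℝ) ^ P.d * (2 * P.d)) / Real.sqrt (((P.L : ℝ) ^ P.d)⁻¹ * (P.L : ℝ) ^ 2)
        * ∑ i ∈ Finset.range k, (159 * α i + 1040 * ((((P.d + 2) * P.L : ℕ) : ℝ) * Real.sqrt (2 * P.d * (P.L : ℝ) ^ P.d))
          * Real.sqrt (((P.L : ℝ) ^ P.d)⁻¹ * (P.L : ℝ) ^ 2) ^ i * X) ≤ 1 / 2)
    (hRowL : ∀ i, i < k → ∀ (V W : GaugeField P i (Matrix.specialUnitaryGroup (Fin 2) ℂ)),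
      ∑ c ∈ S (i + 1), ‖((Fintype.card (Idx P) : ℂ))⁻¹ • ∑ idx : Idx P,
        ((holAt V (walk (emb c.src) (stairWord idx.2.1 (off idx.1))) : Matrix.specialUnitaryGroup (Fin 2) ℂ) : Matrix (Fin 2) (Fin 2) ℂ) *
          covWalkSum V (pertVar V W) (walk (walkEnd (emb c.src) (stairWord idx.2.1 (off idx.1))) (List.replicate P.L (c.dir, true))) *
        star ((holAt V (walk (emb c.src) (stairWord idx.2.1 (off idx.1))) : Matrix.specialUnitaryGroup (Fin 2) ℂ) : Matrix (Fin 2) (Fin 2) ℂ)‖ ^ 2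
      ≤ ((P.L : ℝ) ^ P.d)⁻¹ * (P.L : ℝ) ^ 2 * ∑ b ∈ S i, ‖pertVar V W b‖ ^ 2)
    (hRowM : ∀ i, i < k → ∀ g : PBond P i → ℝ, (∀ b, 0 ≤ g b) →
      ∑ c ∈ S (i + 1), ∑ b ∈ univ.filter (fun b : PBond P i => blockOf b.src = c.src ∨ blockOf b.src = c.tgt), g b ≤ 2 * P.d * ∑ b ∈ S i, g b) :
    ∀ i, i ≤ k → ∃ h : GaugeTransf P i (Matrix.specialUnitaryGroup (Fin 2) ℂ),
      ∑ b ∈ S i, ‖pertVar (Averaging.iter (fun i' => blockAvg (P := P) (j := i') (expMeanLogSU (n := Fin 2))) i U)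
          (GaugeField.gaugeAct h (Averaging.iter (fun i' => blockAvg (P := P) (j := i') (expMeanLogSU (n := Fin 2))) i U')) b‖ ^ 2 ≤
        (X * Real.sqrt (((P.L : ℝ) ^ P.d)⁻¹ * (P.L : ℝ) ^ 2) ^ i *
          Real.exp ((((P.d + 2) * P.L : ℕ) : ℝ) * Real.sqrt (2 * P.d * (P.L : ℝ) ^ P.d * (2 * P.d)) / Real.sqrt (((P.L : ℝ) ^ P.d)⁻¹ * (P.L : ℝ) ^ 2)
            * ∑ i' ∈ Finset.range i, (159 * α i' + 1040 * ((((P.d + 2) * P.L : ℕ) : ℝ) * Real.sqrt (2 * P.d * (P.L : ℝ) ^ P.d))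
              * Real.sqrt (((P.L : ℝ) ^ P.d)⁻¹ * (P.L : ℝ) ^ 2) ^ i' * X))) ^ 2 := by
  -- letters
  set av := (fun i' => blockAvg (P := P) (j := i') (expMeanLogSU (n := Fin 2))) with hav
  set ℓ : ℝ := (((P.d + 2) * P.L : ℕ) : ℝ) with hℓ
  set C₁ : ℝ := ℓ * Real.sqrt (2 * P.d * (P.L : ℝ) ^ P.d) with hC₁
  set ρ : ℝ := Real.sqrt (((P.L : ℝ) ^ P.d)⁻¹ * (P.L : ℝ) ^ 2) with hρ
  set κ : ℝ := ℓ * Real.sqrt (2 * P.d * (P.L : ℝ) ^ P.d * (2 * P.d)) with hκ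
  set qb : ℕ → ℝ := fun i => 159 * α i + 1040 * C₁ * ρ ^ i * X with hqb
  set E : ℕ → ℝ := fun i => Real.exp (κ / ρ * ∑ i' ∈ Finset.range i, qb i') with hE
  have hℓ0 : 0 ≤ ℓ := by positivity
  have hC₁0 : 0 ≤ C₁ := by positivity
  have hκ0 : 0 ≤ κ := by positivity
  have hLpos : (0 : ℝ) < (P.L : ℝ) := by exact_mod_cast P.L_pos
  have hρpos : 0 < ρ := Real.sqrt_pos.2 (by positivity)
  have hρle1 : ρ ≤ 1 := by rw [hρ]; exact Real.sqrt_le_one.mpr hρ1 |>.trans_eq' rfl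
  have hqb0 : ∀ i, i < k → 0 ≤ qb i := fun i hi => by
    have := hα0 i hi; simp only [hqb]; positivity
  -- the exponent never exceeds `1/2`, so `E i ≤ 2` for `i ≤ k`
  have hsum' : κ / ρ * ∑ i' ∈ Finset.range k, qb i' ≤ 1 / 2 := by
    simpa only [hκ, hρ, hqb, hC₁, hℓ, mul_assoc] using hsum
  have hEle : ∀ i, i ≤ k → E i ≤ 2 := by
    intro i hi
    have exp_half_le_two : Real.exp (1 / 2) ≤ 2 := by
      have h := Real.exp_one_lt_d9
      have h2 : Real.exp (1 / 2) ^ 2 = Real.exp 1 := by rw [← Real.exp_nat_mul]; norm_num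
      nlinarith [Real.exp_pos (1 / 2)]

    have hmono : ∑ i' ∈ Finset.range i, qb i' ≤ ∑ i' ∈ Finset.range k, qb i' :=
      Finset.sum_le_sum_of_subset_of_nonneg (Finset.range_mono hi) fun i' hi' _ => hqb0 i' (Finset.mem_range.1 hi')
    have : κ / ρ * ∑ i' ∈ Finset.range i, qb i' ≤ 1 / 2 :=
      (mul_le_mul_of_nonneg_left hmono (div_nonneg hκ0 hρpos.le)).trans hsum'
    exact (Real.exp_le_exp.2 this).trans exp_half_le_two
  have hEpos : ∀ i, 0 < E i := fun i => Real.exp_pos _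
  -- the induction
  intro i
  induction i with
  | zero =>
    intro _
    refine ⟨fun _ => 1, ?_⟩
    rw [gaugeAct_const_one]
    simp only [Finset.range_zero, Finset.sum_empty, mul_zero, Real.exp_zero, pow_zero, mul_one]
    exact hX
  | succ i ih =>
    intro hi1
    have hik : i < k := by omega
    obtain ⟨h, hh⟩ := ih (by omega)
    -- the datum of the step
    set V := Averaging.iter av i U with hVdef
    set W := GaugeField.gaugeAct h (Averaging.iter av i U') with hWdef
    set M : ℝ := X * ρ ^ i * E i with hMdef
    have hM0 : 0 ≤ M := by positivity
    have hρi : ρ ^ i ≤ 1 := pow_le_one₀ hρpos.le hρle1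
    have hM2X : M ≤ 2 * X := by
      have h1 : X * ρ ^ i ≤ X := by nlinarith [pow_nonneg hρpos.le i]
      calc M = X * ρ ^ i * E i := rfl
        _ ≤ X * 2 := by nlinarith [hEle i (by omega), (hEpos i).le, mul_nonneg hX0 (pow_nonneg hρpos.le i)]
        _ = 2 * X := by ring
    have hMsq : ∑ b ∈ S i, ‖pertVar V W b‖ ^ 2 ≤ M ^ 2 := by
      simpa only [hMdef, hVdef, hWdef, hav, hE, hqb, hκ, hρ, hC₁, hℓ, mul_assoc] using hh
    have hsmall : 72 * (C₁ * M) ≤ 1 := by nlinarith [mul_le_mul_of_nonneg_left hM2X hC₁0]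
    have hNi : 3 * (C₁ * M) + α i < deltaSU (Fin 2) := by
      have := hN i hik
      have h6 : 3 * (C₁ * M) ≤ 6 * (C₁ * X) := by nlinarith [mul_le_mul_of_nonneg_left hM2X hC₁0]
      simp only [hC₁, hℓ, mul_assoc] at h6 this ⊢
      linarith
    obtain ⟨g, hg⟩ := exists_regauge_sum_normSq_le (Nat.succ_le_of_lt (Nat.lt_of_lt_of_le hik hk)) V W (S (i + 1)) (S i) (hS i hik)
      hM0 hMsq (hα0 i hik) (fun c hc idx => by simpa only [hVdef, hav] using hα i hik c hc idx) (hα24 i hik)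
      (by simpa only [hC₁, hℓ, mul_assoc] using hsmall) (by simpa only [hC₁, hℓ, mul_assoc] using hNi)
      (by simpa only [hVdef, hWdef] using hRowL i hik V W) (hRowM i hik)
    -- the new gauge `h' := g·(h ∘ emb)` and the identification of the re-gauged average
    refine ⟨fun y => g y * h (emb y), ?_⟩
    have hcov : avgFun (expMeanLogSU (n := Fin 2)) W =
        GaugeField.gaugeAct (fun y => h (emb y)) (Averaging.iter av (i + 1) U') := by
      rw [hWdef, avgFun_covariant (expMeanLogSU (n := Fin 2)) (Nat.succ_le_of_lt (Nat.lt_of_lt_of_le hik hk))]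
      rfl
    have hident : GaugeField.gaugeAct g (avgFun (expMeanLogSU (n := Fin 2)) W) =
        GaugeField.gaugeAct (fun y => g y * h (emb y)) (Averaging.iter av (i + 1) U') := by
      rw [hcov, gaugeAct_mul_gaugeAct]
    have hV' : avgFun (expMeanLogSU (n := Fin 2)) V = Averaging.iter av (i + 1) U := rfl
    rw [hident, hV'] at hg
    refine hg.trans ?_
    -- the bound: `(ρ + κ·(159α + 520C₁M))·M ≤ X ρ^{i+1} E_{i+1}`
    have hq : 159 * α i + 520 * (C₁ * M) ≤ qb i := by
      simp only [hqb]
      nlinarith [mul_le_mul_of_nonneg_left hM2X hC₁0, pow_nonneg hρpos.le i,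
        show C₁ * M = C₁ * (X * ρ ^ i * E i) from rfl, hEle i (by omega), mul_nonneg hC₁0 (mul_nonneg hX0 (pow_nonneg hρpos.le i))]
    have hstep : (ρ + κ * (159 * α i + 520 * (C₁ * M))) * M ≤ X * ρ ^ (i + 1) * E (i + 1) := by
      have h1 : (ρ + κ * (159 * α i + 520 * (C₁ * M))) * M ≤ (ρ + κ * qb i) * M :=
        mul_le_mul_of_nonneg_right (by linarith [mul_le_mul_of_nonneg_left hq hκ0]) hM0
      have h2 : (ρ + κ * qb i) * M ≤ ρ * Real.exp (κ * qb i / ρ) * M := add_mul_le_mul_exp hρpos (mul_nonneg hκ0 (hqb0 i hik)) hM0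
      have h3 : ρ * Real.exp (κ * qb i / ρ) * M = X * ρ ^ (i + 1) * E (i + 1) := by
        simp only [hMdef, hE, Finset.sum_range_succ, mul_add, Real.exp_add, pow_succ]
        have : κ * qb i / ρ = κ / ρ * qb i := by ring
        rw [this]; ring
      exact h1.trans (h2.trans h3.le)
    have hlhs0 : 0 ≤ (ρ + κ * (159 * α i + 520 * (C₁ * M))) * M := by
      have := hα0 i hik; positivity
    have hsq := pow_le_pow_left₀ hlhs0 hstep 2
    simpa only [hMdef, hE, hqb, hκ, hρ, hC₁, hℓ, mul_assoc] using hsq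

/-- ★★★ **THE TOP LEVEL**: `∃ h : GaugeTransf P k SU(2)`, `Σ_{b∈S k}‖pertVar (Ū^{(k)} U) ((Ū^{(k)} U')^h) b‖² ≤ (2·ρ^k·X)²`. [cite: Balaban1985Averaging, Prop. 3 (122)-(126) p.36] -/
theorem exists_regauge_top_sum_normSq_le {k : ℕ} (hk : k ≤ P.m + P.K) (U U' : GaugeField P 0 (Matrix.specialUnitaryGroup (Fin 2) ℂ))
    (S : (i : ℕ) → Finset (PBond P i))
    (hS : ∀ i, i < k → ∀ c ∈ S (i + 1), ∀ b : PBond P i, (blockOf b.src = c.src ∨ blockOf b.src = c.tgt) → b ∈ S i)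
    (α : ℕ → ℝ) (hα0 : ∀ i, i < k → 0 ≤ α i) (hα24 : ∀ i, i < k → α i ≤ 1 / 24)
    (hα : ∀ i, i < k → ∀ c ∈ S (i + 1), ∀ idx : Idx P,
      dist1 (loopHol (Averaging.iter (fun i' => blockAvg (P := P) (j := i') (expMeanLogSU (n := Fin 2))) i U) c idx) ≤ α i)
    {X : ℝ} (hX0 : 0 ≤ X) (hX : ∑ b ∈ S 0, ‖pertVar U U' b‖ ^ 2 ≤ X ^ 2)
    (hρ1 : ((P.L : ℝ) ^ P.d)⁻¹ * (P.L : ℝ) ^ 2 ≤ 1)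
    (hsmallX : 144 * ((((P.d + 2) * P.L : ℕ) : ℝ) * Real.sqrt (2 * P.d * (P.L : ℝ) ^ P.d) * X) ≤ 1)
    (hN : ∀ i, i < k → 6 * ((((P.d + 2) * P.L : ℕ) : ℝ) * Real.sqrt (2 * P.d * (P.L : ℝ) ^ P.d) * X) + α i < deltaSU (Fin 2))
    (hsum : (((P.d + 2) * P.L : ℕ) : ℝ) * Real.sqrt (2 * P.d * (P.L : ℝ) ^ P.d * (2 * P.d)) / Real.sqrt (((P.L : ℝ) ^ P.d)⁻¹ * (P.L : ℝ) ^ 2)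
        * ∑ i ∈ Finset.range k, (159 * α i + 1040 * ((((P.d + 2) * P.L : ℕ) : ℝ) * Real.sqrt (2 * P.d * (P.L : ℝ) ^ P.d))
          * Real.sqrt (((P.L : ℝ) ^ P.d)⁻¹ * (P.L : ℝ) ^ 2) ^ i * X) ≤ 1 / 2)
    (hRowL : ∀ i, i < k → ∀ (V W : GaugeField P i (Matrix.specialUnitaryGroup (Fin 2) ℂ)),
      ∑ c ∈ S (i + 1), ‖((Fintype.card (Idx P) : ℂ))⁻¹ • ∑ idx : Idx P,
        ((holAt V (walk (emb c.src) (stairWord idx.2.1 (off idx.1))) : Matrix.specialUnitaryGroup (Fin 2) ℂ) : Matrix (Fin 2) (Fin 2) ℂ) *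
          covWalkSum V (pertVar V W) (walk (walkEnd (emb c.src) (stairWord idx.2.1 (off idx.1))) (List.replicate P.L (c.dir, true))) *
        star ((holAt V (walk (emb c.src) (stairWord idx.2.1 (off idx.1))) : Matrix.specialUnitaryGroup (Fin 2) ℂ) : Matrix (Fin 2) (Fin 2) ℂ)‖ ^ 2
      ≤ ((P.L : ℝ) ^ P.d)⁻¹ * (P.L : ℝ) ^ 2 * ∑ b ∈ S i, ‖pertVar V W b‖ ^ 2)
    (hRowM : ∀ i, i < k → ∀ g : PBond P i → ℝ, (∀ b, 0 ≤ g b) →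
      ∑ c ∈ S (i + 1), ∑ b ∈ univ.filter (fun b : PBond P i => blockOf b.src = c.src ∨ blockOf b.src = c.tgt), g b ≤ 2 * P.d * ∑ b ∈ S i, g b) :
    ∃ h : GaugeTransf P k (Matrix.specialUnitaryGroup (Fin 2) ℂ),
      ∑ b ∈ S k, ‖pertVar (Averaging.iter (fun i' => blockAvg (P := P) (j := i') (expMeanLogSU (n := Fin 2))) k U)
          (GaugeField.gaugeAct h (Averaging.iter (fun i' => blockAvg (P := P) (j := i') (expMeanLogSU (n := Fin 2))) k U')) b‖ ^ 2 ≤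
        (2 * Real.sqrt (((P.L : ℝ) ^ P.d)⁻¹ * (P.L : ℝ) ^ 2) ^ k * X) ^ 2 := by
  obtain ⟨h, hh⟩ := exists_regauged_tower hk U U' S hS α hα0 hα24 hα hX0 hX hρ1 hsmallX hN hsum hRowL hRowM k le_rfl
  refine ⟨h, hh.trans (pow_le_pow_left₀ (by positivity) ?_ 2)⟩
  -- `X ρ^k E_k ≤ 2 ρ^k X`
  have hE : Real.exp ((((P.d + 2) * P.L : ℕ) : ℝ) * Real.sqrt (2 * P.d * (P.L : ℝ) ^ P.d * (2 * P.d)) / Real.sqrt (((P.L : ℝ) ^ P.d)⁻¹ * (P.L : ℝ) ^ 2)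
            * ∑ i' ∈ Finset.range k, (159 * α i' + 1040 * ((((P.d + 2) * P.L : ℕ) : ℝ) * Real.sqrt (2 * P.d * (P.L : ℝ) ^ P.d))
              * Real.sqrt (((P.L : ℝ) ^ P.d)⁻¹ * (P.L : ℝ) ^ 2) ^ i' * X)) ≤ 2 := by
    have exp_half_le_two : Real.exp (1 / 2) ≤ 2 := by
      have h := Real.exp_one_lt_d9
      have h2 : Real.exp (1 / 2) ^ 2 = Real.exp 1 := by rw [← Real.exp_nat_mul]; norm_num
      nlinarith [Real.exp_pos (1 / 2)]
    exact (Real.exp_le_exp.2 hsum).trans exp_half_le_two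
  have hρk : 0 ≤ Real.sqrt (((P.L : ℝ) ^ P.d)⁻¹ * (P.L : ℝ) ^ 2) ^ k := pow_nonneg (Real.sqrt_nonneg _) k
  nlinarith [mul_nonneg hX0 hρk, Real.exp_pos ((((P.d + 2) * P.L : ℕ) : ℝ) * Real.sqrt (2 * P.d * (P.L : ℝ) ^ P.d * (2 * P.d)) / Real.sqrt (((P.L : ℝ) ^ P.d)⁻¹ * (P.L : ℝ) ^ 2)
            * ∑ i' ∈ Finset.range k, (159 * α i' + 1040 * ((((P.d + 2) * P.L : ℕ) : ℝ) * Real.sqrt (2 * P.d * (P.L : ℝ) ^ P.d))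
              * Real.sqrt (((P.L : ℝ) ^ P.d)⁻¹ * (P.L : ℝ) ^ 2) ^ i' * X))]

end Summit.QuantumFields.YangMills.Theorems.PoincareLipschitzRegaugedTowerInduction

end
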